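import Mathlib
import Literature.AlgebraicGeometry.Tropical.TorusCycles
import Summits.HodgeConjecture.HodgeConjecture.Theorems.TropicalWeilObstructionTropicalWeilVanishingTransportFrames
import Summits.HodgeConjecture.HodgeConjecture.Theorems.TropicalWeilObstructionTropicalHodgeBoundClassesEigenwave
import HarnessLib

/-!
# The pure-wall germ at the split point: an equidistance identity valid at every Weil period (K1-SCOPE §8)

Helper for crux K1 (`TropicalWeilVanishing`, stmt-HodgeConjecture-18478) of route
`TropicalWeilObstruction` — negation-sink work of cell `pub-hodge-tropical` (tropical-1 gen 12); it
decides nothing about K1 and nothing here bears on the Hodge conjecture.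

Write a Weil period as `Q = [[A, B], [-B, A]]` (`A` symmetric, `B` antisymmetric — exactly the
symmetric `2n × 2n` matrices commuting with `J = weilJ n`), and points of `ℝ²ⁿ = ℝⁿ × ℝⁿ` as `(a | b)`.
The odd second-order tropical theta divisor attached to the `J`-orbit `{(e|0), (0|e)}` of a
characteristic `e ∈ 𝔽₂ⁿ ∖ 0` (a "coordinate" odd divisor; at `n = 2` these are b04's `A, B, C`) is the
`Q`-Voronoi boundary of the coset union `(ℤ²ⁿ + (e|0)/2) ∪ (ℤ²ⁿ + (0|e)/2)`, and a point `y = (u | v)` is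
TIED on it when two coset points are `Q`-equidistant and nearest. The theorem below is the identity
behind the persistent "pure-wall germ" of HOME `certificates/splitgerms/`: for EVERY vector `e`, every
`w`, and every Weil period,
`‖y − (0 | w − e/2)‖²_Q − ‖y − (e/2 | w)‖²_Q = e · (A(u + v − w) − B(u − v + w))`,
so on the `n`-plane `{A(u+v−w) = B(u−v+w)}` (the antidiagonal graph; at `B = 0` it is `u + v = w`)
ALL `2ⁿ − 1` coordinate odd divisors are tied simultaneously, at every period of the 16-dimensional
(n = 4) family — the `n`-dimensional form of the mechanism that produces van Geemen's tropical 2-cycle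
at `n = 2` (its 76 diagonal-plane cells are exactly this germ). Pure bilinear algebra; no cycle is
constructed here and nothing is claimed about nearest points.

References: Zharkov, *Tropical abelian varieties, Weil classes and the Hodge conjecture* (2020), §2;
van Geemen, *An introduction to the Hodge conjecture for abelian varieties* (1994), §7.
-/

noncomputable section

-- `Summit.HodgeConjecture.HodgeConjecture.…` is the mandated namespace (single-conjunct summit).
set_option linter.dupNamespace false

open scoped BigOperators Matrix
open Matrix Literature.AlgebraicGeometry.Tropical

namespace Summit.HodgeConjecture.HodgeConjecture.Theorems.TropicalWeilVanishing.SplitGerm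

variable {n : ℕ}

/-- Symmetric bilinear form: `a · A b = b · A a` when `Aᵀ = A`. [folklore] -/
theorem dotProduct_mulVec_comm_of_transpose_eq (A : Matrix (Fin n) (Fin n) ℝ) (hA : Aᵀ = A)
    (a b : Fin n → ℝ) : a ⬝ᵥ A *ᵥ b = b ⬝ᵥ A *ᵥ a := by
  rw [Matrix.dotProduct_mulVec, ← Matrix.mulVec_transpose, hA, dotProduct_comm]

/-- Antisymmetric bilinear form: `a · B b = -(b · B a)` when `Bᵀ = -B`. [folklore] -/
theorem dotProduct_mulVec_anticomm_of_transpose_eq_neg (B : Matrix (Fin n) (Fin n) ℝ)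
    (hB : Bᵀ = -B) (a b : Fin n → ℝ) : a ⬝ᵥ B *ᵥ b = -(b ⬝ᵥ B *ᵥ a) := by
  rw [Matrix.dotProduct_mulVec, ← Matrix.mulVec_transpose, hB, Matrix.neg_mulVec, dotProduct_comm,
    dotProduct_neg]

/-- **The pure-wall germ identity (block form).** For a Weil period `Q = [[A, B], [-B, A]]`
(`Aᵀ = A`, `Bᵀ = -B`) write `‖(a | b)‖²_Q = a·Aa + 2 a·Bb + b·Ab`. Then for all `u v w e`,
`‖(u | v − w + e/2)‖²_Q − ‖(u − e/2 | v − w)‖²_Q = e·A(u+v−w) − e·B(u−v+w)`: the point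
`y = (u | v)` is `Q`-equidistant from `(0 | w − e/2)` and `(e/2 | w)` iff
`e · (A(u+v−w) − B(u−v+w)) = 0`, for every `e` at once on `{A(u+v−w) = B(u−v+w)}`. [folklore] -/
theorem normSq_sub_normSq_wallPair (A B : Matrix (Fin n) (Fin n) ℝ) (hA : Aᵀ = A) (hB : Bᵀ = -B)
    (u v w e : Fin n → ℝ) :
    (u ⬝ᵥ A *ᵥ u + 2 * (u ⬝ᵥ B *ᵥ (v - w + (2 : ℝ)⁻¹ • e))
        + (v - w + (2 : ℝ)⁻¹ • e) ⬝ᵥ A *ᵥ (v - w + (2 : ℝ)⁻¹ • e))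
      - ((u - (2 : ℝ)⁻¹ • e) ⬝ᵥ A *ᵥ (u - (2 : ℝ)⁻¹ • e)
        + 2 * ((u - (2 : ℝ)⁻¹ • e) ⬝ᵥ B *ᵥ (v - w)) + (v - w) ⬝ᵥ A *ᵥ (v - w))
      = e ⬝ᵥ A *ᵥ (u + v - w) - e ⬝ᵥ B *ᵥ (u - v + w) := by
  have sA := dotProduct_mulVec_comm_of_transpose_eq A hA
  have sB := dotProduct_mulVec_anticomm_of_transpose_eq_neg B hB
  simp only [Matrix.mulVec_add, Matrix.mulVec_sub, Matrix.mulVec_smul, dotProduct_add,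
    dotProduct_sub, dotProduct_smul, add_dotProduct, sub_dotProduct, smul_dotProduct, smul_eq_mul]
  simp only [sA w v, sA v e, sA w e, sA u e, sB u e]
  ring

/-- **Corollary (the germ is tied for every `e` at once).** On the set `{A(u+v−w) = B(u−v+w)}` the
two points `(0 | w − e/2)` and `(e/2 | w)` are `Q`-equidistant from `(u | v)` for EVERY vector `e` —
in particular for all `2ⁿ − 1` coordinate characteristics simultaneously, at every Weil period. [folklore] -/
theorem normSq_eq_normSq_wallPair_of_mem_germ (A B : Matrix (Fin n) (Fin n) ℝ) (hA : Aᵀ = A)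
    (hB : Bᵀ = -B) (u v w : Fin n → ℝ) (hgerm : A *ᵥ (u + v - w) = B *ᵥ (u - v + w))
    (e : Fin n → ℝ) :
    u ⬝ᵥ A *ᵥ u + 2 * (u ⬝ᵥ B *ᵥ (v - w + (2 : ℝ)⁻¹ • e))
        + (v - w + (2 : ℝ)⁻¹ • e) ⬝ᵥ A *ᵥ (v - w + (2 : ℝ)⁻¹ • e)
      = (u - (2 : ℝ)⁻¹ • e) ⬝ᵥ A *ᵥ (u - (2 : ℝ)⁻¹ • e)
        + 2 * ((u - (2 : ℝ)⁻¹ • e) ⬝ᵥ B *ᵥ (v - w)) + (v - w) ⬝ᵥ A *ᵥ (v - w) := by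
  have h := normSq_sub_normSq_wallPair A B hA hB u v w e
  rw [hgerm, sub_self] at h
  exact sub_eq_zero.mp h

/-- **Bridge to the `2n × 2n` period.** If `Q` has the block shape `[[A, B], [-B, A]]` (entries
`Q k l = A k l`, `Q k (l+n) = B k l`, `Q (k+n) l = -B k l`, `Q (k+n) (l+n) = A k l`) and `z` has halves
`a`, `b`, then `z · Q z = a·Aa + 2 a·Bb + b·Ab` provided `Bᵀ = -B`. [folklore] -/
theorem dotProduct_mulVec_eq_blocks (Q : Matrix (Fin (2 * n)) (Fin (2 * n)) ℝ)
    (A B : Matrix (Fin n) (Fin n) ℝ) (hB : Bᵀ = -B)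
    (h11 : ∀ k l : Fin n, Q ⟨(k : ℕ), by omega⟩ ⟨(l : ℕ), by omega⟩ = A k l)
    (h12 : ∀ k l : Fin n, Q ⟨(k : ℕ), by omega⟩ ⟨(l : ℕ) + n, by omega⟩ = B k l)
    (h21 : ∀ k l : Fin n, Q ⟨(k : ℕ) + n, by omega⟩ ⟨(l : ℕ), by omega⟩ = -B k l)
    (h22 : ∀ k l : Fin n, Q ⟨(k : ℕ) + n, by omega⟩ ⟨(l : ℕ) + n, by omega⟩ = A k l)
    (z : Fin (2 * n) → ℝ) (a b : Fin n → ℝ)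
    (ha : ∀ k : Fin n, z ⟨(k : ℕ), by omega⟩ = a k) (hb : ∀ k : Fin n, z ⟨(k : ℕ) + n, by omega⟩ = b k) :
    z ⬝ᵥ Q *ᵥ z = a ⬝ᵥ A *ᵥ a + 2 * (a ⬝ᵥ B *ᵥ b) + b ⬝ᵥ A *ᵥ b := by
  have sB := dotProduct_mulVec_anticomm_of_transpose_eq_neg B hB
  simp only [dotProduct, Matrix.mulVec, sum_fin_two_mul, ha, hb, h11, h12, h21, h22]
  have hba : ∑ k : Fin n, b k * ∑ l : Fin n, -B k l * a l = ∑ k : Fin n, a k * ∑ l : Fin n, B k l * b l := by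
    have h := sB b a
    simp only [dotProduct, Matrix.mulVec] at h
    have : ∑ k : Fin n, b k * ∑ l : Fin n, -B k l * a l = -(∑ k : Fin n, b k * ∑ l : Fin n, B k l * a l) := by
      rw [← Finset.sum_neg_distrib]
      refine Finset.sum_congr rfl fun k _ => ?_
      rw [← mul_neg, ← Finset.sum_neg_distrib]
      refine congrArg _ (Finset.sum_congr rfl fun l _ => by ring)
    rw [this, h, neg_neg]
  simp only [Finset.sum_add_distrib, mul_add]
  rw [hba]
  ring

/-- **The pure-wall germ identity, tree vocabulary.** For a symmetric period `Q` commuting with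
`J = weilJ n` (so `Q = [[A, B], [-B, A]]` with `A_{kl} = Q_{kl}`, `B_{kl} = Q_{k,l+n}`), a point `y = (u | v)`
and the two coset points `p = (0 | w − e/2)`, `p' = (e/2 | w)`:
`(y−p)·Q(y−p) − (y−p')·Q(y−p') = e·A(u+v−w) − e·B(u−v+w)`. Hence on the germ `{A(u+v−w) = B(u−v+w)}`
every coordinate odd divisor `{(e|0),(0|e)}` has these two points `Q`-equidistant from `y`, at every
Weil period (HOME `certificates/splitgerms/`). [folklore] -/
theorem normSq_sub_normSq_wallPair_of_weilJ_comm (Q : Matrix (Fin (2 * n)) (Fin (2 * n)) ℝ)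
    (hS : Qᵀ = Q) (hJ : Q * weilJ n = weilJ n * Q) (u v w e : Fin n → ℝ)
    (y p p' : Fin (2 * n) → ℝ)
    (hyl : ∀ k : Fin n, y ⟨(k : ℕ), by omega⟩ = u k) (hyh : ∀ k : Fin n, y ⟨(k : ℕ) + n, by omega⟩ = v k)
    (hpl : ∀ k : Fin n, p ⟨(k : ℕ), by omega⟩ = 0)
    (hph : ∀ k : Fin n, p ⟨(k : ℕ) + n, by omega⟩ = w k - (2 : ℝ)⁻¹ * e k)
    (hp'l : ∀ k : Fin n, p' ⟨(k : ℕ), by omega⟩ = (2 : ℝ)⁻¹ * e k)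
    (hp'h : ∀ k : Fin n, p' ⟨(k : ℕ) + n, by omega⟩ = w k) :
    (y - p) ⬝ᵥ Q *ᵥ (y - p) - (y - p') ⬝ᵥ Q *ᵥ (y - p') =
      e ⬝ᵥ (Matrix.of fun k l : Fin n => Q ⟨(k : ℕ), by omega⟩ ⟨(l : ℕ), by omega⟩) *ᵥ (u + v - w)
        - e ⬝ᵥ (Matrix.of fun k l : Fin n => Q ⟨(k : ℕ), by omega⟩ ⟨(l : ℕ) + n, by omega⟩) *ᵥ
            (u - v + w) := by
  set A : Matrix (Fin n) (Fin n) ℝ := Matrix.of fun k l : Fin n => Q ⟨(k : ℕ), by omega⟩ ⟨(l : ℕ), by omega⟩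
    with hAdef
  set B : Matrix (Fin n) (Fin n) ℝ :=
    Matrix.of fun k l : Fin n => Q ⟨(k : ℕ), by omega⟩ ⟨(l : ℕ) + n, by omega⟩ with hBdef
  have hQs : ∀ i j : Fin (2 * n), Q i j = Q j i := fun i j => by
    simpa [Matrix.transpose_apply] using (congrFun (congrFun hS i) j).symm
  have hA : Aᵀ = A := by
    ext k l; simp only [hAdef, Matrix.transpose_apply, Matrix.of_apply]; exact hQs _ _
  have hB : Bᵀ = -B := by
    ext k l
    simp only [hBdef, Matrix.transpose_apply, Matrix.of_apply, Matrix.neg_apply]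
    rw [TropicalHodgeBound.apply_lo_hi_of_weilJ_comm Q hJ k l, neg_neg]
    exact hQs _ _
  have h11 : ∀ k l : Fin n, Q ⟨(k : ℕ), by omega⟩ ⟨(l : ℕ), by omega⟩ = A k l := fun k l => rfl
  have h12 : ∀ k l : Fin n, Q ⟨(k : ℕ), by omega⟩ ⟨(l : ℕ) + n, by omega⟩ = B k l := fun k l => rfl
  have h21 : ∀ k l : Fin n, Q ⟨(k : ℕ) + n, by omega⟩ ⟨(l : ℕ), by omega⟩ = -B k l := fun k l => by
    simp only [hBdef, Matrix.of_apply]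
    have h := TropicalHodgeBound.apply_lo_hi_of_weilJ_comm Q hJ k l
    linarith
  have h22 : ∀ k l : Fin n, Q ⟨(k : ℕ) + n, by omega⟩ ⟨(l : ℕ) + n, by omega⟩ = A k l := fun k l =>
    TropicalHodgeBound.apply_hi_hi_of_weilJ_comm Q hJ k l
  have hz1 := dotProduct_mulVec_eq_blocks Q A B hB h11 h12 h21 h22 (y - p) u
    (v - w + (2 : ℝ)⁻¹ • e) (fun k => by simp [hyl, hpl]) (fun k => by simp [hyh, hph]; ring)
  have hz2 := dotProduct_mulVec_eq_blocks Q A B hB h11 h12 h21 h22 (y - p') (u - (2 : ℝ)⁻¹ • e)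
    (v - w) (fun k => by simp [hyl, hp'l]) (fun k => by simp [hyh, hp'h])
  rw [hz1, hz2]
  exact normSq_sub_normSq_wallPair A B hA hB u v w e

/-! ## The two pairing lemmas behind the persistence RULES (tropical-1 gen 12, appended)

In the persistence criterion (HOME `certificates/splitgerms/README` §1) a relation `ε` among the tie
differences of an excess cell contributes `Σ_j ε_j m_jᵀ D d_j`, `D = [[S, T], [-T, S]] ∈ Sym_J`. For two
divisors sharing one sheet (or one `L`-type competitor) this is `cᵀ T b` resp. `cᵀ S b` with `c` the
offset of the other-half nearest points and `b` the common difference vector; the two lemmas below are the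
linear algebra that turns "vanishes for all antisymmetric `T`" into "`c ∥ b`" (the SHEET-SHARING rule
`a ≡ e + e' (mod 2)` and the `L`-type DEAD-END rule) and "vanishes for all symmetric `S`" into
"`c = 0` or `b = 0`". Nothing tropical is used. -/

/-- `Σ_x Σ_y c_x [x = i ∧ y = j] b_y = c_i b_j`. [folklore] -/
theorem sum_sum_mul_ite_and_eq (c b : Fin n → ℝ) (i j : Fin n) :
    (∑ x, ∑ y, c x * (if x = i ∧ y = j then b y else 0)) = c i * b j := by
  rw [Finset.sum_eq_single i]
  · rw [Finset.sum_eq_single j]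
    · simp
    · intro l _ hl; simp [hl]
    · simp
  · intro k _ hk
    exact Finset.sum_eq_zero fun l _ => by simp [hk]
  · simp

/-- **Antisymmetric pairings (the algebra of the L-type DEAD-END rule).** For real vectors `c, b`:
`cᵀ T b = 0` for every antisymmetric matrix `T` iff all `2 × 2` minors of `(c | b)` vanish, i.e. iff
`c` and `b` are proportional. In the persistence criterion the `B`-directions of `Sym_J` pair a midpoint
offset `c` with a tie difference `b` exactly through such a `T`; so a sheet (or an `L`-type competitor)
can be shared persistently by two coordinate divisors only if the offset of their other-half nearest
points is parallel to the difference vector (HOME `certificates/splitgerms/README` §5). [folklore] -/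
theorem forall_transpose_eq_neg_dotProduct_mulVec_eq_zero_iff (c b : Fin n → ℝ) :
    (∀ T : Matrix (Fin n) (Fin n) ℝ, Tᵀ = -T → c ⬝ᵥ T *ᵥ b = 0) ↔ ∀ i j, c i * b j = c j * b i := by
  constructor
  · intro h i j
    have hT : (Matrix.of fun k l : Fin n =>
        ((if k = i ∧ l = j then (1 : ℝ) else 0) - (if k = j ∧ l = i then 1 else 0)))ᵀ =
        -(Matrix.of fun k l : Fin n =>
        ((if k = i ∧ l = j then (1 : ℝ) else 0) - (if k = j ∧ l = i then 1 else 0))) := by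
      ext k l
      simp only [transpose_apply, of_apply]
      by_cases h1 : k = i <;> by_cases h2 : l = j <;> by_cases h3 : k = j <;> by_cases h4 : l = i <;>
        simp_all
    have hv := h _ hT
    simp only [dotProduct, mulVec, of_apply, sub_mul, Finset.sum_sub_distrib, mul_sub, ite_mul, one_mul,
      zero_mul, Finset.mul_sum] at hv
    rw [sum_sum_mul_ite_and_eq c b i j, sum_sum_mul_ite_and_eq c b j i] at hv
    linarith
  · intro h T hT
    have hT' : ∀ k l, T l k = -T k l := fun k l => by
      have := congrFun (congrFun hT k) l
      simpa [transpose_apply] using this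
    have e1 : c ⬝ᵥ T *ᵥ b = ∑ k, ∑ l, c k * T k l * b l := by
      simp only [dotProduct, mulVec, Finset.mul_sum, mul_assoc]
    have e2 : ∑ k, ∑ l, c k * T k l * b l = ∑ k, ∑ l, c l * T l k * b k := Finset.sum_comm
    have e3 : ∑ k, ∑ l, c l * T l k * b k = -∑ k, ∑ l, c k * T k l * b l := by
      rw [← Finset.sum_neg_distrib]
      refine Finset.sum_congr rfl fun k _ => ?_
      rw [← Finset.sum_neg_distrib]
      refine Finset.sum_congr rfl fun l _ => ?_
      rw [hT' k l]
      have hh := h l k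
      linear_combination (-(T k l)) * hh
    have : ∑ k, ∑ l, c k * T k l * b l = 0 := by linarith [e2.trans e3]
    rw [e1, this]

/-- **Symmetric pairings (the algebra of the SHEET-SHARING rule in the `A`-directions).** For real
vectors `c, b`: `cᵀ S b = 0` for every symmetric matrix `S` iff `c = 0` or `b = 0`. [folklore] -/
theorem forall_transpose_eq_dotProduct_mulVec_eq_zero_iff (c b : Fin n → ℝ) :
    (∀ S : Matrix (Fin n) (Fin n) ℝ, Sᵀ = S → c ⬝ᵥ S *ᵥ b = 0) ↔ c = 0 ∨ b = 0 := by
  constructor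
  · intro h
    -- the elementary symmetric matrices E_{ij} + E_{ji}
    have hS : ∀ i j : Fin n, (Matrix.of fun k l : Fin n =>
        ((if k = i ∧ l = j then (1 : ℝ) else 0) + (if k = j ∧ l = i then 1 else 0)))ᵀ =
        (Matrix.of fun k l : Fin n =>
        ((if k = i ∧ l = j then (1 : ℝ) else 0) + (if k = j ∧ l = i then 1 else 0))) := by
      intro i j; ext k l
      simp only [transpose_apply, of_apply]
      by_cases h1 : k = i <;> by_cases h2 : l = j <;> by_cases h3 : k = j <;> by_cases h4 : l = i <;>
        simp_all [add_comm]
    have hval : ∀ i j : Fin n, c i * b j + c j * b i = 0 := by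
      intro i j
      have hv := h _ (hS i j)
      simp only [dotProduct, mulVec, of_apply, add_mul, Finset.sum_add_distrib, mul_add, ite_mul, one_mul,
        zero_mul, Finset.mul_sum] at hv
      rw [sum_sum_mul_ite_and_eq c b i j, sum_sum_mul_ite_and_eq c b j i] at hv
      exact hv
    by_cases hc : c = 0
    · exact Or.inl hc
    by_cases hb : b = 0
    · exact Or.inr hb
    exfalso
    obtain ⟨i, hi⟩ : ∃ i, c i ≠ 0 := Function.ne_iff.mp hc
    obtain ⟨j, hj⟩ : ∃ j, b j ≠ 0 := Function.ne_iff.mp hb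
    have hbi : b i = 0 := by
      have h2 : c i * b i = 0 := by linarith [hval i i]
      rcases mul_eq_zero.mp h2 with h' | h'
      · exact absurd h' hi
      · exact h'
    have hcj : c j = 0 := by
      have h2 : c j * b j = 0 := by linarith [hval j j]
      rcases mul_eq_zero.mp h2 with h' | h'
      · exact h'
      · exact absurd h' hj
    have h3 := hval i j
    rw [hcj, hbi] at h3
    have : c i * b j = 0 := by linarith
    rcases mul_eq_zero.mp this with h' | h'
    · exact hi h'
    · exact hj h'
  · rintro (rfl | rfl) S _
    · simp
    · simp

end Summit.HodgeConjecture.HodgeConjecture.Theorems.TropicalWeilVanishing.SplitGerm
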